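import Summits.ResolutionOfSingularities.ResolutionOfSingularities.Theorems.RadicialJungCleanModelsStubCurveStalks
import Summits.ResolutionOfSingularities.ResolutionOfSingularities.Theorems.RadicialJungCleanModelsStubGenerator
import Mathlib.RingTheory.IntegralClosure.IntegrallyClosed
import Mathlib.RingTheory.DedekindDomain.IntegralClosure
import Mathlib.LinearAlgebra.Dimension.Localization
import Mathlib.FieldTheory.PurelyInseparable.Basic
import Mathlib.AlgebraicGeometry.FunctionField
import HarnessLib

set_option linter.dupNamespace false -- mandated namespace of this single-conjunct summit

/-!
# The integral closure of a local ring of a variety in a radicial extension of degree `p`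

Crux `Picover` (stmt-ResolutionOfSingularities-0554), line `giraud-separated-base`, stub
`integralClosure_stalk_radicial`.

**Setting.** `k` a field of characteristic `p`, `W` an integral scheme locally of finite type over
`k`, `L ⊇ K(W)` purely inseparable of degree `p`, `w ∈ W` a point whose local ring
`O = 𝒪_{W,w}` is integrally closed; `L` is an `O`-algebra through `O → K(W) → L` and
`S = integralClosure O L` is the stalk at the point over `w` of the normalization `W^L`.

**Claim.** `char O = p`; `S` is a finite, faithful, integrally closed `O`-algebra of generic rank
`[S : O] = p`; and `S` is *radicial* over `O`: `s ^ p ∈ O` for every `s ∈ S`.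

**Proof.** `O` receives a ring map from the field `k`, so `char O = p`.  Finiteness is
E. Noether's theorem localised (`RadicialJung.CleanModels.finite_integralClosure_stalk`).
`O → S` is injective because `O → K(W) → L` is.  `S` is integrally closed since `L/K(W)` is finite
(Mathlib `integralClosure.isIntegrallyClosedOfFiniteExtension`).  `L` is the localisation of `S`
at `O ∖ 0` (Mathlib `IsIntegralClosure.isLocalization`), so
`rank_O S = rank_O L = rank_{K(W)} L = p` (Mathlib `IsLocalizedModule.finrank_eq`,
`IsLocalization.rank_eq`).  Finally, in a purely inseparable extension of degree `p` every
element has its `p`-th power in the base field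
(`RadicialJung.CleanModels.exists_algebraMap_eq_pow_of_finrank_eq`); for `s ∈ S` the element
`s ^ p ∈ K(W)` is integral over the integrally closed `O`, hence lies in `O`.
-/

noncomputable section

open CategoryTheory AlgebraicGeometry
open scoped nonZeroDivisors

universe u v w

namespace Summit.ResolutionOfSingularities.ResolutionOfSingularities.Theorems.Picover.IntegralClosureStalk

/-- **Abstract form.** Let `O` be an integrally closed domain of prime characteristic `p` with
fraction field `K`, and `L ⊇ K` purely inseparable of degree `p`, viewed as an `O`-algebra through
`K`.  Then the integral closure `S` of `O` in `L` is a faithful, integrally closed `O`-algebra of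
generic rank `p` with `S^p ⊆ O`. -/
theorem integralClosure_radicial {p : ℕ} (hp : p.Prime) {O : Type u} {K : Type v} {L : Type w}
    [CommRing O] [IsDomain O] [CharP O p] [IsIntegrallyClosed O] [Field K] [Algebra O K]
    [IsFractionRing O K] [Field L] [Algebra K L] [Algebra O L] [IsScalarTower O K L]
    [IsPurelyInseparable K L] (hdeg : Module.finrank K L = p) :
    FaithfulSMul O (integralClosure O L) ∧ IsIntegrallyClosed (integralClosure O L) ∧
      Module.finrank O (integralClosure O L) = p ∧
      ∀ s : integralClosure O L, s ^ p ∈ (algebraMap O (integralClosure O L)).range := by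
  haveI : FiniteDimensional K L := Module.finite_of_finrank_pos (by rw [hdeg]; exact hp.pos)
  have hOK : Function.Injective (algebraMap O K) := IsFractionRing.injective O K
  haveI : CharP K p := charP_of_injective_algebraMap hOK p
  -- `O → L` is injective, hence so is `O → S`
  have hOL : Function.Injective (algebraMap O L) := by
    rw [IsScalarTower.algebraMap_eq O K L]
    exact (algebraMap K L).injective.comp hOK
  have hfaith : FaithfulSMul O (integralClosure O L) :=
    (faithfulSMul_iff_algebraMap_injective O _).mpr fun a b h =>
      hOL (congrArg Subtype.val h)
  -- `S` is integrally closed (its fraction field is `L`)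
  have hic : IsIntegrallyClosed (integralClosure O L) :=
    integralClosure.isIntegrallyClosedOfFiniteExtension K
  -- `L` is the localisation of `S` at `O ∖ 0`, so `rank_O S = rank_O L = rank_K L`
  haveI : Algebra.IsAlgebraic K L := Algebra.IsAlgebraic.of_finite K L
  haveI : IsLocalization (Algebra.algebraMapSubmonoid (integralClosure O L) O⁰) L :=
    IsIntegralClosure.isLocalization O K L (integralClosure O L)
  have h1 : Module.finrank O L = Module.finrank O (integralClosure O L) :=
    IsLocalizedModule.finrank_eq O⁰
      (IsScalarTower.toAlgHom O (integralClosure O L) L).toLinearMap le_rfl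
  have h2 : Module.rank K L = Module.rank O L := IsLocalization.rank_eq K O⁰ le_rfl
  have hrank : Module.finrank O (integralClosure O L) = p := by
    rw [← h1, ← hdeg, Module.finrank, Module.finrank, h2]
  refine ⟨hfaith, hic, hrank, fun s => ?_⟩
  -- `s ^ p = x ∈ K` is integral over `O`, hence `x ∈ O`
  obtain ⟨x, hx⟩ :=
    RadicialJung.CleanModels.exists_algebraMap_eq_pow_of_finrank_eq p hp hdeg (s : L)
  have hxint : IsIntegral O x := by
    have h := (s.2 : IsIntegral O (s : L)).pow p
    rw [← hx] at h
    exact (isIntegral_algebraMap_iff (algebraMap K L).injective).mp h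
  obtain ⟨r, hr⟩ := IsIntegrallyClosed.algebraMap_eq_of_integral hxint
  refine ⟨r, Subtype.ext ?_⟩
  change algebraMap O L r = ((s ^ p : integralClosure O L) : L)
  rw [IsScalarTower.algebraMap_apply O K L, hr, hx]
  rfl

/-- **The integral closure of `𝒪_{W,w}` in a radicial extension of degree `p`.**  For `W` an
integral scheme locally of finite type over a field `k` of characteristic `p`, `L ⊇ K(W)` purely
inseparable of degree `p` and `w ∈ W` with `𝒪_{W,w}` integrally closed, the integral closure `S`
of `𝒪_{W,w}` in `L` (an `𝒪_{W,w}`-algebra through `K(W)`) satisfies: `char 𝒪_{W,w} = p`, `S` is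
finite (E. Noether, localised), faithful and integrally closed over `𝒪_{W,w}`, of generic rank
`p`, and `S^p ⊆ 𝒪_{W,w}`. -/
theorem integralClosure_stalk_radicial : ∀ (p : ℕ) [Fact p.Prime] (k : Type) [Field k] [CharP k p] (W : Scheme.{0}) [IsIntegral W] (f : W ⟶ Spec (.of k)) [LocallyOfFiniteType f] (L : Type) [Field L] [Algebra W.functionField L] [IsPurelyInseparable W.functionField L], Module.finrank W.functionField L = p → ∀ (w : W), letI : Algebra (W.presheaf.stalk w) L := ((algebraMap W.functionField L).comp (algebraMap (W.presheaf.stalk w) W.functionField)).toAlgebra; IsIntegrallyClosed (W.presheaf.stalk w) → CharP (W.presheaf.stalk w) p ∧ Module.Finite (W.presheaf.stalk w) (integralClosure (W.presheaf.stalk w) L) ∧ FaithfulSMul (W.presheaf.stalk w) (integralClosure (W.presheaf.stalk w) L) ∧ IsIntegrallyClosed (integralClosure (W.presheaf.stalk w) L) ∧ Module.finrank (W.presheaf.stalk w) (integralClosure (W.presheaf.stalk w) L) = p ∧ ∀ s : integralClosure (W.presheaf.stalk w) L, s ^ p ∈ (algebraMap (W.presheaf.stalk w) (integralClosure (W.presheaf.stalk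 w) L)).range := by
  intro p _ k _ _ W _ f _ L _ _ _ hdeg w
  letI algOL : Algebra (W.presheaf.stalk w) L :=
    ((algebraMap W.functionField L).comp (algebraMap (W.presheaf.stalk w) W.functionField)).toAlgebra
  intro hO
  haveI := hO
  have hp : p.Prime := Fact.out
  haveI : IsScalarTower (W.presheaf.stalk w) W.functionField L :=
    IsScalarTower.of_algebraMap_eq fun _ => rfl
  haveI : FiniteDimensional W.functionField L :=
    Module.finite_of_finrank_pos (by rw [hdeg]; exact hp.pos)
  -- `char 𝒪_{W,w} = p`: the local ring receives the ring map `k → Γ(W, ⊤) → 𝒪_{W,w}`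
  haveI : CharP (W.presheaf.stalk w) p :=
    ((((W.presheaf.germ ⊤ w trivial).hom.comp
      (f.appTop.hom.comp (Scheme.ΓSpecIso (.of k)).inv.hom)).charP_iff_charP p).mp
      inferInstance)
  obtain ⟨h3, h4, h5, h6⟩ :=
    integralClosure_radicial (O := W.presheaf.stalk w) (K := W.functionField) (L := L) hp hdeg
  exact ⟨inferInstance, RadicialJung.CleanModels.finite_integralClosure_stalk W f L w, h3, h4, h5,
    h6⟩

end Summit.ResolutionOfSingularities.ResolutionOfSingularities.Theorems.Picover.IntegralClosureStalk

end
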